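import Summits.BirchSwinnertonDyer.BirchSwinnertonDyer.Theorems.ManinLocalTwoThreeEulerRemaindersThirtyTwo
import HarnessLib

/-!
# The Euler functions at level 64: `E₄ = 1 − q⁴ − q⁸ + o(q⁸)`, `E₈ = 1 − q⁸ + o(q⁸)` (and derivatives);
# the `η`-quotients `y₆₄`, `φ₆₄` as `q`-monomials times Euler functions; the derivative of `y₆₄`

Cell bsd-f2-manin, route `ManinLocalTwoThree` (crux C2 `ManinOddAtFour`: `2⁶ = 64`, the first GENUS-THREE level of the
domain), prover seat p3 gen 23; toolkit for the three `q`-limits (T1)₆₄–(T3)₆₄ of `ManinLocalTwoThreeEtaLimitsSixtyFour`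
(the level-`64` twin of `ManinLocalTwoThreeEulerRemaindersThirtyTwo`).

RECONNAISSANCE (p3 g23, exact `q`-series arithmetic, `work/g3/recon.py`): the optimal curve `64a1 : y² = x³ − 4x` of
`X₀(64)` is parametrised by `η`-quotients — `x∘φ = X₃₂ = η(16τ)⁶/(η(8τ)²η(32τ)⁴)` (the SAME modular function as the
`x`-coordinate of `X₀(32) → 32a1 : y² = x³ + 4x`, tree: `EtaIdentityReductionThirtyTwo`) and
`y∘φ = y₆₄ = η(4τ)²η(16τ)⁴/(η(8τ)²η(32τ)⁴)`, with newform `φ₆₄ = η(8τ)⁸/(η(4τ)²η(16τ)²) = q + 2q⁵ − 3q⁹ − 6q¹³ + 2q¹⁷ − ⋯`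
(Martin–Ono's list of weight-2 `η`-quotient newforms).  With `E_δ = ∏(1 − q^{δn})` (`eulerFn δ`):

* `E₄ = 1 − q⁴ − q⁸ + o(q⁸)`, `E₄′ = 2πi(−4q⁴ − 8q⁸) + o(q⁸)`, `E₈ = 1 − q⁸ + o(q⁸)`, `E₈′ = 2πi(−8q⁸) + o(q⁸)`
  (`tendsto_eulerFn_four_eight`, `…_deriv_…`, `tendsto_eulerFn_eight_eight`, `…_deriv_…`); `E₁₆, E₃₂ = 1 + o(q⁸)` are
  `EulerRemainders.tendsto_eulerFn`;
* `y₆₄ = E₄²E₁₆⁴/(q³E₈²E₃₂⁴)`, `φ₆₄ = q E₈⁸/(E₄²E₁₆²)` (`y64_eq`, `phi64_eq`; `X₃₂ = E₁₆⁶/(q²E₈²E₃₂⁴)` is `X32_eq`);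
* the logarithmic derivative `deriv_y64` (`deriv_X32` is in the level-`32` file).

Pure `q`-series analysis; nothing here proves C2, Manin's conjecture or BSD. [cite: Ligozat1975, Ch. 3] [cite: MartinOno1997, Thm. 2]
-/

set_option autoImplicit false
set_option linter.dupNamespace false

noncomputable section

open Complex Filter Topology Set Asymptotics Polynomial
open UpperHalfPlane hiding I
open scoped Real Topology Manifold MatrixGroups
open Literature.NumberTheory.EllipticCurves Literature.NumberTheory.EllipticCurves.ModularForms

namespace Summit.BirchSwinnertonDyer.BirchSwinnertonDyer.Theorems.ManinLocalTwoThree.EulerRemaindersSixtyFour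

open QRemainder EulerRemainders EulerRemaindersThirtyTwo
open LigozatIdentities (hasDerivAt_eulerFn_comp)

/-! ## 1. `E₄` and `E₈` to order `q⁸` -/

/-- The first nine `q`-coefficients of `E₄`: `1, 0, 0, 0, −1, 0, 0, 0, −1`. [folklore] -/
theorem coeff_formalEulerScaled_four_le_eight (n : ℕ) (hn : n ≤ 8) :
    PowerSeries.coeff n (formalEulerScaled 4)
      = if n = 0 then 1 else if n = 4 then -1 else if n = 8 then -1 else 0 := by
  obtain ⟨h0, h1, h2⟩ := coeff_formalEulerPow_one_of_le_two
  interval_cases n <;> simp +decide [coeff_formalEulerScaled, h0, h1, h2]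

/-- The first nine `q`-coefficients of `E₈`: `1, 0, 0, 0, 0, 0, 0, 0, −1`. [folklore] -/
theorem coeff_formalEulerScaled_eight (n : ℕ) (hn : n ≤ 8) :
    PowerSeries.coeff n (formalEulerScaled 8) = if n = 0 then 1 else if n = 8 then -1 else 0 := by
  obtain ⟨h0, h1, -⟩ := coeff_formalEulerPow_one_of_le_two
  interval_cases n <;> simp +decide [coeff_formalEulerScaled, h0, h1]

/-- **`E₄ = 1 − q⁴ − q⁸ + o(q⁸)`.** [folklore] -/
theorem tendsto_eulerFn_four_eight :
    Tendsto (fun τ : ℍ ↦ (eulerFn 4 τ - (1 - X ^ 4 - X ^ 8 : ℂ[X]).eval (Function.Periodic.qParam 1 (τ : ℂ)))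
      / Function.Periodic.qParam 1 (τ : ℂ) ^ 8) atImInfty (𝓝 0) := by
  refine congr_poly ?_ (tendsto_of_hasSum (periodic_eulerFn 4) (mdifferentiable_eulerFn 4)
    (isBoundedAtImInfty_eulerFn (by norm_num)) (hasSum_eulerFn (by norm_num)) 8)
  have h := coeff_formalEulerScaled_four_le_eight
  simp only [Finset.sum_range_succ, Finset.sum_range_zero, h 0 (by norm_num), h 1 (by norm_num),
    h 2 (by norm_num), h 3 (by norm_num), h 4 (by norm_num), h 5 (by norm_num), h 6 (by norm_num),
    h 7 (by norm_num), h 8 (by norm_num)]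
  norm_num
  ring

/-- **`E₄′ = 2πi(−4q⁴ − 8q⁸) + o(q⁸)`.** [folklore] -/
theorem tendsto_deriv_eulerFn_four_eight :
    Tendsto (fun τ : ℍ ↦ (deriv (eulerFn 4 ∘ ofComplex) τ
      - (C (2 * π * I) * (-4 * X ^ 4 - 8 * X ^ 8) : ℂ[X]).eval (Function.Periodic.qParam 1 (τ : ℂ)))
      / Function.Periodic.qParam 1 (τ : ℂ) ^ 8) atImInfty (𝓝 0) := by
  refine congr_poly ?_ (congr_fun (fun τ ↦ deriv_eulerFn_sub_one 4 τ)
    (tendsto_deriv_of_isCuspFunction (isCuspFunction_eulerFn_sub_one (by norm_num : 0 < 4)) 8))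
  have h := coeff_formalEulerScaled_four_le_eight
  have hc : ∀ n : ℕ, n ≠ 0 → n ≤ 8 → (qExpansion 1 (eulerFn 4 - 1)).coeff n
      = (((if n = 0 then 1 else if n = 4 then -1 else if n = 8 then -1 else 0 : ℤ)) : ℂ) :=
    fun n hn hn8 ↦ by rw [qExpansion_eulerFn_sub_one_coeff_of_ne_zero (by norm_num) hn, h n hn8]
  simp only [Finset.sum_range_succ, Finset.sum_range_zero, hc 1 one_ne_zero (by norm_num),
    hc 2 (by norm_num) (by norm_num), hc 3 (by norm_num) (by norm_num), hc 4 (by norm_num) (by norm_num),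
    hc 5 (by norm_num) (by norm_num), hc 6 (by norm_num) (by norm_num), hc 7 (by norm_num) (by norm_num),
    hc 8 (by norm_num) (by norm_num)]
  norm_num
  simp only [map_ofNat]
  ring

/-- **`E₈ = 1 − q⁸ + o(q⁸)`.** [folklore] -/
theorem tendsto_eulerFn_eight_eight :
    Tendsto (fun τ : ℍ ↦ (eulerFn 8 τ - (1 - X ^ 8 : ℂ[X]).eval (Function.Periodic.qParam 1 (τ : ℂ)))
      / Function.Periodic.qParam 1 (τ : ℂ) ^ 8) atImInfty (𝓝 0) := by
  refine congr_poly ?_ (tendsto_of_hasSum (periodic_eulerFn 8) (mdifferentiable_eulerFn 8)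
    (isBoundedAtImInfty_eulerFn (by norm_num)) (hasSum_eulerFn (by norm_num)) 8)
  have h := coeff_formalEulerScaled_eight
  simp only [Finset.sum_range_succ, Finset.sum_range_zero, h 0 (by norm_num), h 1 (by norm_num),
    h 2 (by norm_num), h 3 (by norm_num), h 4 (by norm_num), h 5 (by norm_num), h 6 (by norm_num),
    h 7 (by norm_num), h 8 (by norm_num)]
  norm_num
  ring

/-- **`E₈′ = 2πi(−8q⁸) + o(q⁸)`.** [folklore] -/
theorem tendsto_deriv_eulerFn_eight_eight :
    Tendsto (fun τ : ℍ ↦ (deriv (eulerFn 8 ∘ ofComplex) τ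
      - (C (2 * π * I) * (-8 * X ^ 8) : ℂ[X]).eval (Function.Periodic.qParam 1 (τ : ℂ)))
      / Function.Periodic.qParam 1 (τ : ℂ) ^ 8) atImInfty (𝓝 0) := by
  refine congr_poly ?_ (congr_fun (fun τ ↦ deriv_eulerFn_sub_one 8 τ)
    (tendsto_deriv_of_isCuspFunction (isCuspFunction_eulerFn_sub_one (by norm_num : 0 < 8)) 8))
  have h := coeff_formalEulerScaled_eight
  have hc : ∀ n : ℕ, n ≠ 0 → n ≤ 8 → (qExpansion 1 (eulerFn 8 - 1)).coeff n
      = (((if n = 0 then 1 else if n = 8 then -1 else 0 : ℤ)) : ℂ) :=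
    fun n hn hn8 ↦ by rw [qExpansion_eulerFn_sub_one_coeff_of_ne_zero (by norm_num) hn, h n hn8]
  simp only [Finset.sum_range_succ, Finset.sum_range_zero, hc 1 one_ne_zero (by norm_num),
    hc 2 (by norm_num) (by norm_num), hc 3 (by norm_num) (by norm_num), hc 4 (by norm_num) (by norm_num),
    hc 5 (by norm_num) (by norm_num), hc 6 (by norm_num) (by norm_num), hc 7 (by norm_num) (by norm_num),
    hc 8 (by norm_num) (by norm_num)]
  norm_num
  simp only [map_ofNat]
  ring

/-! ## 2. `y₆₄` and `φ₆₄` in terms of `q` and the Euler functions -/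

/-- `e^{2πiτ·(24k)/24} = qᵏ`. [folklore] -/
theorem cexp_eq_qParam_pow (τ : ℍ) (k : ℕ) :
    cexp (2 * π * I * τ / 24 * (((24 * k : ℕ) : ℤ) : ℂ)) = Function.Periodic.qParam 1 (τ : ℂ) ^ k := by
  rw [Function.Periodic.qParam, ← Complex.exp_nat_mul]
  congr 1
  push_cast
  ring

/-- **`y₆₄ = η(4τ)²η(16τ)⁴/(η(8τ)²η(32τ)⁴) = E₄²E₁₆⁴/(q³E₈²E₃₂⁴)`** (the `y`-coordinate of `X₀(64) → 64a1`, an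
`η`-quotient of level `64`). [folklore] -/
theorem y64_eq (τ : ℍ) :
    etaQuotient 64 (expFn [(4, 2), (8, -2), (16, 4), (32, -4)]) τ
      = eulerFn 4 τ ^ 2 * eulerFn 16 τ ^ 4
        / (Function.Periodic.qParam 1 (τ : ℂ) ^ 3 * eulerFn 8 τ ^ 2 * eulerFn 32 τ ^ 4) := by
  have hE8 := eulerFn_ne_zero (by norm_num : 0 < 8) τ
  have hE32 := eulerFn_ne_zero (by norm_num : 0 < 32) τ
  have hq := qParam_ne_zero τ
  rw [etaQuotient_eq_cexp_mul_prod, show Nat.divisors 64 = {1, 2, 4, 8, 16, 32, 64} by decide]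
  have hsum : (∑ δ ∈ ({1, 2, 4, 8, 16, 32, 64} : Finset ℕ),
      (δ : ℤ) * expFn [(4, 2), (8, -2), (16, 4), (32, -4)] δ) = (-(24 * 3 : ℕ) : ℤ) := by decide
  rw [hsum, cexp_neg_eq_inv_qParam_pow]
  rw [Finset.prod_insert (by decide), Finset.prod_insert (by decide), Finset.prod_insert (by decide),
    Finset.prod_insert (by decide), Finset.prod_insert (by decide), Finset.prod_insert (by decide),
    Finset.prod_singleton]
  rw [show expFn [(4, 2), (8, -2), (16, 4), (32, -4)] 1 = 0 by decide,
    show expFn [(4, 2), (8, -2), (16, 4), (32, -4)] 2 = 0 by decide,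
    show expFn [(4, 2), (8, -2), (16, 4), (32, -4)] 4 = 2 by decide,
    show expFn [(4, 2), (8, -2), (16, 4), (32, -4)] 8 = -2 by decide,
    show expFn [(4, 2), (8, -2), (16, 4), (32, -4)] 16 = 4 by decide,
    show expFn [(4, 2), (8, -2), (16, 4), (32, -4)] 32 = -4 by decide,
    show expFn [(4, 2), (8, -2), (16, 4), (32, -4)] 64 = 0 by decide]
  simp only [zpow_neg, zpow_ofNat]
  field_simp

/-- **`φ₆₄ = η(8τ)⁸/(η(4τ)²η(16τ)²) = q E₈⁸/(E₄²E₁₆²)`** (the newform of `64a1`, as an `η`-quotient of level `64`).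
[cite: MartinOno1997, Thm. 2] -/
theorem phi64_eq (τ : ℍ) :
    etaQuotient 64 (expFn [(4, -2), (8, 8), (16, -2)]) τ
      = Function.Periodic.qParam 1 (τ : ℂ) * eulerFn 8 τ ^ 8 / (eulerFn 4 τ ^ 2 * eulerFn 16 τ ^ 2) := by
  have hE4 := eulerFn_ne_zero (by norm_num : 0 < 4) τ
  have hE16 := eulerFn_ne_zero (by norm_num : 0 < 16) τ
  rw [etaQuotient_eq_cexp_mul_prod, show Nat.divisors 64 = {1, 2, 4, 8, 16, 32, 64} by decide]
  have hsum : (∑ δ ∈ ({1, 2, 4, 8, 16, 32, 64} : Finset ℕ),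
      (δ : ℤ) * expFn [(4, -2), (8, 8), (16, -2)] δ) = ((24 * 1 : ℕ) : ℤ) := by decide
  rw [hsum, cexp_eq_qParam_pow, pow_one]
  rw [Finset.prod_insert (by decide), Finset.prod_insert (by decide), Finset.prod_insert (by decide),
    Finset.prod_insert (by decide), Finset.prod_insert (by decide), Finset.prod_insert (by decide),
    Finset.prod_singleton]
  rw [show expFn [(4, -2), (8, 8), (16, -2)] 1 = 0 by decide,
    show expFn [(4, -2), (8, 8), (16, -2)] 2 = 0 by decide,
    show expFn [(4, -2), (8, 8), (16, -2)] 4 = -2 by decide,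
    show expFn [(4, -2), (8, 8), (16, -2)] 8 = 8 by decide,
    show expFn [(4, -2), (8, 8), (16, -2)] 16 = -2 by decide,
    show expFn [(4, -2), (8, 8), (16, -2)] 32 = 0 by decide,
    show expFn [(4, -2), (8, 8), (16, -2)] 64 = 0 by decide]
  simp only [zpow_neg, zpow_ofNat]
  field_simp

/-! ## 3. The derivative of `y₆₄` -/

/-- **`y₆₄′ = y₆₄ · (2E₄′/E₄ + 4E₁₆′/E₁₆ − 3·2πi − 2E₈′/E₈ − 4E₃₂′/E₃₂)`.** [folklore] -/
theorem deriv_y64 (τ : ℍ) :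
    deriv (etaQuotient 64 (expFn [(4, 2), (8, -2), (16, 4), (32, -4)]) ∘ ofComplex) τ
      = eulerFn 4 τ ^ 2 * eulerFn 16 τ ^ 4
          / (Function.Periodic.qParam 1 (τ : ℂ) ^ 3 * eulerFn 8 τ ^ 2 * eulerFn 32 τ ^ 4)
        * (2 * deriv (eulerFn 4 ∘ ofComplex) τ / eulerFn 4 τ
          + 4 * deriv (eulerFn 16 ∘ ofComplex) τ / eulerFn 16 τ - 3 * (2 * π * I)
          - 2 * deriv (eulerFn 8 ∘ ofComplex) τ / eulerFn 8 τ
          - 4 * deriv (eulerFn 32 ∘ ofComplex) τ / eulerFn 32 τ) := by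
  have hE4 := eulerFn_ne_zero (by norm_num : 0 < 4) τ
  have hE8 := eulerFn_ne_zero (by norm_num : 0 < 8) τ
  have hE16 := eulerFn_ne_zero (by norm_num : 0 < 16) τ
  have hE32 := eulerFn_ne_zero (by norm_num : 0 < 32) τ
  have hq := qParam_ne_zero τ
  have hfun : (etaQuotient 64 (expFn [(4, 2), (8, -2), (16, 4), (32, -4)]) ∘ ofComplex) =ᶠ[𝓝 (τ : ℂ)]
      fun z ↦ (eulerFn 4 ∘ ofComplex) z ^ 2 * (eulerFn 16 ∘ ofComplex) z ^ 4
        / (Function.Periodic.qParam 1 z ^ 3 * (eulerFn 8 ∘ ofComplex) z ^ 2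
          * (eulerFn 32 ∘ ofComplex) z ^ 4) := by
    filter_upwards [isOpen_upperHalfPlaneSet.mem_nhds τ.im_pos] with z hz
    simp only [Function.comp_apply, y64_eq, ofComplex_apply_of_im_pos hz]
  rw [hfun.deriv_eq]
  have h4 := hasDerivAt_eulerFn_comp 4 τ
  have h8 := hasDerivAt_eulerFn_comp 8 τ
  have h16 := hasDerivAt_eulerFn_comp 16 τ
  have h32 := hasDerivAt_eulerFn_comp 32 τ
  have hqd : HasDerivAt (Function.Periodic.qParam 1) (2 * π * I * Function.Periodic.qParam 1 (τ : ℂ)) τ := by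
    simpa using hasDerivAt_qParam 1 (τ : ℂ)
  have hden : Function.Periodic.qParam 1 (τ : ℂ) ^ 3 * (eulerFn 8 ∘ ofComplex) τ ^ 2
      * (eulerFn 32 ∘ ofComplex) τ ^ 4 ≠ 0 := by
    simp only [Function.comp_apply, ofComplex_apply]
    exact mul_ne_zero (mul_ne_zero (pow_ne_zero _ hq) (pow_ne_zero _ hE8)) (pow_ne_zero _ hE32)
  have hD := ((h4.fun_pow 2).fun_mul (h16.fun_pow 4)).fun_div
    (((hqd.fun_pow 3).fun_mul (h8.fun_pow 2)).fun_mul (h32.fun_pow 4)) hden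
  rw [hD.deriv]
  simp only [Function.comp_apply, ofComplex_apply]
  field_simp
  ring

end Summit.BirchSwinnertonDyer.BirchSwinnertonDyer.Theorems.ManinLocalTwoThree.EulerRemaindersSixtyFour

end
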